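import Summits.AtomisticToContinuum.HydrodynamicLimit.Theorems.CollisionIsometryCLTDiffuseBackwardInfluenceOnePathBound
import Summits.AtomisticToContinuum.HydrodynamicLimit.Theorems.CollisionIsometryCLTDiffuseBackwardInfluenceRowBudgetN
import HarnessLib

/-!
# `DiffuseBackwardInfluence`, line `share-nondegeneracy-one-flight`: the share large deviation reduced to prescribed
particle sets (stub `stub_oneFlightShareLD`, lead prover)

Crux `stmt-AtomisticToContinuum-12950` (`CollisionIsometryCLT.DiffuseBackwardInfluence`), line
`share-nondegeneracy-one-flight` (`Cruxes/DiffuseBackwardInfluence/PICKED.md`). The registered HARDEST stub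
`stub_oneFlightShareLD` asserts, for `σ < σ₀`, every temperature `θ`, every fraction `δ` and every rate `h`, an
`η₀ > 0` such that for `η < η₀` the FRACTION-LEVEL event `{degFr ≥ δ}` ("the tracer-mass-weighted fraction of particles whose
FIRST collision after the slot boundary hands over an `η`-degenerate share is `≥ δ`") has `eqLaw σ θ`-probability
`≤ e^{−h(N+1)}` on every slot of every admissible window, eventually in `N` (`ShareLDAt`).

This file does for the lever what the wave-1 workers did for the other two dynamical inputs (`FewIdle.TubeLD`,
`LateMerges.LateTouchRare`): it ISOLATES the open content as ONE named proposition and lands the reduction.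

* `ShareLD.ShareSetLD σ θ` (`@[conjecture]`): the PRESCRIBED-SET joint share-degeneracy large deviation — for every
  fixed index set `A` with `|A| ≥ δ(N+1)`, the event "EVERY particle of `A` collides in the slot and has degeneracy score
  `degScore ≥ δ`" has probability `≤ e^{−h(N+1)}`, uniformly in `A`, eventually in `N`, for `η < η₀(δ, h)`. This is
  exactly the shape the one-flight argument of the idea card proves (sequential revelation along the time-ordered
  collisions: each scoring collision of a particle of `A` puts its unit normal in a past-determined cap ∪ band of solid
  angle `O(√η/δ)`; an upper conditional density bound `K(σ)` for the next normal gives `(K C√η/δ)^{|A|/2}`), and exactly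
  the analogue of `FewIdle.TubeLD` (prescribed set `A`, union taken in the reduction).
* `ShareLD.card_filter_ge_half`: scores in `[0,1]` with sum `≥ δ n` have at least `(δ/2) n` entries `≥ δ/2` (Markov).
* `ShareLD.setOf_le_degFr_subset`: `{δ ≤ degFr} ⊆ ⋃_{|A| ≥ (δ/2)(N+1)} {∀ i ∈ A, δ/2 ≤ degScore_i}` — uses the LANDED row
  budget (`stub_rowBudgetN`: `degScore ≤ 1`, truncation of `degFr` inactive, `OnePath.degFr_eq`).
* `shareLD_of_shareSetLD` (REGISTERED sub-goal): `ShareSetLD σ θ` implies the `(δ, h, η₀, η, Φ)`-tail of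
  `stub_oneFlightShareLD` at `(σ, θ)` — union bound over the `≤ 2^{N+1}` index sets at rate `h + 1`
  (`2^{N+1} e^{−(h+1)(N+1)} ≤ e^{−h(N+1)}` because `2 ≤ e`).

Nothing here is asserted: `ShareSetLD` is a predicate (obligation node), consumed as a hypothesis.
-/

namespace Summit.AtomisticToContinuum.HydrodynamicLimit.Theorems.DiffuseBackwardInfluenceShare

open scoped BigOperators Topology ENNReal Classical
open Filter Set MeasureTheory
open Summit.AtomisticToContinuum.HydrodynamicLimit.Theorems.DiffuseBackwardInfluenceNeg

noncomputable section

namespace ShareLD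

/-- **THE PRESCRIBED-SET SHARE LARGE DEVIATION** at reduced density `σ` and temperature `θ` — an OPEN named conjecture
of this programme (obligation node; the one-flight lever of idea card `share-nondegeneracy-one-flight`): for every
fraction `δ > 0` and rate `h > 0` there is `η₀ > 0` such that for `0 < η < η₀`, every admissible window `Δ_N`, every slot
`r < S` of every grid, eventually in `N`, for every flow `Φ` (a dummy of `eqLaw`) and EVERY index set `A` with
`|A| ≥ δ(N+1)`: the `eqLaw σ θ`-probability that every particle of `A` collides in slot `r` with an `η`-share-degenerate
FIRST collision of score `degScore ≥ δ` is `≤ exp (−h(N+1))`. Intended proof (not in the tree or in print): along the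
time-ordered collisions, a scoring collision of `i ∈ A` forces its unit normal into a set of solid angle `≤ C√η/δ`
determined by `i`'s transfer blocks at the slot boundary (cap/band inclusions + Markov over sources); a one-flight UPPER
conditional density bound `K(σ)` for the next normal given the coarse past (forward-unstable impact offset expanded by
`ℓ/ε = (√2πσ³)⁻¹`; shields only remove support) and the fact that each collision involves `≤ 2` particles of `A` give
`≤ (K C √η/δ)^{|A|/2}`, whose rate `(δ/2) log(δ/(K C√η))` exceeds `h` for `η < η₀(σ, δ, h)`. -/
@[conjecture] def ShareSetLD (σ θ : ℝ) : Prop :=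
  ∀ δ h : ℝ, 0 < δ → 0 < h → ∃ η₀ : ℝ, 0 < η₀ ∧ ∀ η : ℝ, 0 < η → η < η₀ →
    ∀ Δ : ℕ → ℝ, (∀ N, 0 < Δ N) → Tendsto Δ atTop (𝓝 0) →
      Tendsto (fun N : ℕ => Δ N * ((N + 1 : ℕ) : ℝ) ^ ((1 : ℝ) / 3)) atTop atTop →
      ∀ S r : ℕ, 1 ≤ S → r < S →
        ∀ᶠ N : ℕ in atTop, ∀ (Φ : Flow σ N) (A : Finset (Fin (N + 1))),
          δ * ((N : ℝ) + 1) ≤ (A.card : ℝ) →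
            eqLaw σ θ N Φ {y : Cfg N | ∀ i ∈ A, δ ≤ degScore σ N y (Δ N) S r η i} ≤
              ENNReal.ofReal (Real.exp (-(h * ((N : ℝ) + 1))))

/-- MARKOV ON SCORES: if `n` numbers `≤ 1` sum to at least `δ n` (`δ ≥ 0`), then at least `(δ/2) n` of them are
`≥ δ/2`. [folklore] -/
theorem card_filter_ge_half {n : ℕ} (s : Fin n → ℝ) (h1 : ∀ i, s i ≤ 1) {δ : ℝ} (hδ : 0 ≤ δ)
    (hsum : δ * (n : ℝ) ≤ ∑ i, s i) :
    δ / 2 * (n : ℝ) ≤ ((Finset.univ.filter fun i => δ / 2 ≤ s i).card : ℝ) := by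
  classical
  set A := Finset.univ.filter fun i : Fin n => δ / 2 ≤ s i with hA
  have hsplit : ∑ i, s i = ∑ i ∈ A, s i + ∑ i ∈ Finset.univ.filter (fun i : Fin n => ¬ δ / 2 ≤ s i), s i :=
    (Finset.sum_filter_add_sum_filter_not Finset.univ (fun i : Fin n => δ / 2 ≤ s i) s).symm
  have hAle : ∑ i ∈ A, s i ≤ (A.card : ℝ) := by
    calc ∑ i ∈ A, s i ≤ ∑ _i ∈ A, (1 : ℝ) := Finset.sum_le_sum fun i _ => h1 i
      _ = (A.card : ℝ) := by simp
  have hBle : ∑ i ∈ Finset.univ.filter (fun i : Fin n => ¬ δ / 2 ≤ s i), s i ≤ δ / 2 * (n : ℝ) := by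
    calc ∑ i ∈ Finset.univ.filter (fun i : Fin n => ¬ δ / 2 ≤ s i), s i
        ≤ ∑ _i ∈ Finset.univ.filter (fun i : Fin n => ¬ δ / 2 ≤ s i), δ / 2 :=
          Finset.sum_le_sum fun i hi => (not_le.1 (Finset.mem_filter.1 hi).2).le
      _ = ((Finset.univ.filter (fun i : Fin n => ¬ δ / 2 ≤ s i)).card : ℝ) * (δ / 2) := by
          rw [Finset.sum_const, nsmul_eq_mul]
      _ ≤ (n : ℝ) * (δ / 2) := by
          gcongr
          calc (Finset.univ.filter (fun i : Fin n => ¬ δ / 2 ≤ s i)).card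
              ≤ (Finset.univ : Finset (Fin n)).card := Finset.card_filter_le _ _
            _ = n := by simp
      _ = δ / 2 * (n : ℝ) := by ring
  rw [hsplit] at hsum
  linarith

/-- Arithmetic of the union bound over index sets: `2^{n} e^{−(h+1) n} ≤ e^{−h n}` (as `2 ≤ e`). [folklore] -/
theorem two_pow_mul_exp_le (h : ℝ) (n : ℕ) :
    (2 : ℝ) ^ n * Real.exp (-((h + 1) * (n : ℝ))) ≤ Real.exp (-(h * (n : ℝ))) := by
  have hkey : Real.exp (-((h + 1) * (n : ℝ))) = Real.exp (-(h * (n : ℝ))) * Real.exp (-(n : ℝ)) := by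
    rw [← Real.exp_add]; congr 1; ring
  rw [hkey]
  have h2e : (2 : ℝ) ≤ Real.exp 1 := by
    have := Real.add_one_le_exp (1 : ℝ)
    linarith
  have hpow : (2 : ℝ) ^ n ≤ Real.exp (n : ℝ) := by
    calc (2 : ℝ) ^ n ≤ (Real.exp 1) ^ n := pow_le_pow_left₀ (by norm_num) h2e n
      _ = Real.exp ((n : ℝ) * 1) := (Real.exp_nat_mul 1 n).symm
      _ = Real.exp (n : ℝ) := by rw [mul_one]
  have h1 : (2 : ℝ) ^ n * Real.exp (-(n : ℝ)) ≤ 1 := by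
    rw [Real.exp_neg, ← div_eq_mul_inv, div_le_one (Real.exp_pos _)]
    exact hpow
  have hpos := Real.exp_pos (-(h * (n : ℝ)))
  calc (2 : ℝ) ^ n * (Real.exp (-(h * (n : ℝ))) * Real.exp (-(n : ℝ)))
      = Real.exp (-(h * (n : ℝ))) * ((2 : ℝ) ^ n * Real.exp (-(n : ℝ))) := by ring
    _ ≤ Real.exp (-(h * (n : ℝ))) * 1 := by gcongr
    _ = Real.exp (-(h * (n : ℝ))) := mul_one _

/-- THE FRACTION-LEVEL EVENT INSIDE THE UNION OF PRESCRIBED-SET EVENTS: if `degFr ≥ δ` then some index set `A` with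
`|A| ≥ (δ/2)(N+1)` has all its particles with `degScore ≥ δ/2` (row budget: every score is `≤ 1`, and the truncation of
`degFr` at `1` is inactive). [folklore] -/
theorem setOf_le_degFr_subset {σ : ℝ} (hRB : RowBudgetN σ) (N : ℕ) (Δ : ℝ) (S r : ℕ) (η δ : ℝ) (hδ : 0 ≤ δ) :
    {y : Cfg N | δ ≤ degFr σ N y Δ S r η} ⊆
      ⋃ A ∈ (Finset.univ : Finset (Finset (Fin (N + 1)))).filter
          (fun A => δ / 2 * ((N : ℝ) + 1) ≤ (A.card : ℝ)),
        {y : Cfg N | ∀ i ∈ A, δ / 2 ≤ degScore σ N y Δ S r η i} := by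
  intro y hy
  simp only [Set.mem_setOf_eq] at hy
  rw [OnePath.degFr_eq hRB] at hy
  have hN : (0 : ℝ) < ((N + 1 : ℕ) : ℝ) := by positivity
  have hsum : δ * ((N + 1 : ℕ) : ℝ) ≤ ∑ i : Fin (N + 1), degScore σ N y Δ S r η i := by
    rw [mul_comm]
    exact (le_inv_mul_iff₀ hN).1 hy
  have hcard := card_filter_ge_half (fun i => degScore σ N y Δ S r η i)
    (fun i => OnePath.degScore_le_one hRB y Δ S r η i) hδ hsum
  set A₀ := Finset.univ.filter fun i : Fin (N + 1) => δ / 2 ≤ degScore σ N y Δ S r η i with hA₀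
  have hmem : A₀ ∈ (Finset.univ : Finset (Finset (Fin (N + 1)))).filter
      (fun A => δ / 2 * ((N : ℝ) + 1) ≤ (A.card : ℝ)) := by
    refine Finset.mem_filter.2 ⟨Finset.mem_univ _, ?_⟩
    have : ((N + 1 : ℕ) : ℝ) = (N : ℝ) + 1 := by push_cast; ring
    rw [← this]
    exact hcard
  refine Set.mem_biUnion hmem ?_
  simp only [Set.mem_setOf_eq]
  intro i hi
  exact (Finset.mem_filter.1 hi).2

/-- The number of index sets is `2^{N+1}`. [folklore] -/
theorem card_filter_sets_le (N : ℕ) (p : Finset (Fin (N + 1)) → Prop) [DecidablePred p] :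
    ((Finset.univ : Finset (Finset (Fin (N + 1)))).filter p).card ≤ 2 ^ (N + 1) := by
  calc ((Finset.univ : Finset (Finset (Fin (N + 1)))).filter p).card
      ≤ (Finset.univ : Finset (Finset (Fin (N + 1)))).card := Finset.card_filter_le _ _
    _ = 2 ^ (N + 1) := by rw [Finset.card_univ, Fintype.card_finset, Fintype.card_fin]

end ShareLD

/-- **REGISTERED SUB-GOAL — the reduction of the lever to prescribed particle sets:** at every `(σ, θ)`, the
prescribed-set share large deviation `ShareLD.ShareSetLD σ θ` implies the `(δ, h)`-tail of `stub_oneFlightShareLD` at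
`(σ, θ)`: `η₀ := η₀(δ/2, h+1)`; for `η < η₀` and every slot, `{δ ≤ degFr} ⊆ ⋃_{|A| ≥ (δ/2)(N+1)} {∀ i ∈ A, δ/2 ≤ degScore_i}`
(`ShareLD.setOf_le_degFr_subset`, row budget `stub_rowBudgetN`), a union of `≤ 2^{N+1}` events each of probability
`≤ e^{−(h+1)(N+1)}` eventually and uniformly in `A`, and `2^{N+1} e^{−(h+1)(N+1)} ≤ e^{−h(N+1)}`. No measurability is
needed (outer measure: `measure_mono`, `measure_biUnion_finset_le`). [folklore] -/
theorem shareLD_of_shareSetLD : ∀ σ θ : ℝ, ShareLD.ShareSetLD σ θ → ∀ δ h : ℝ, 0 < δ → 0 < h → ∃ η₀ : ℝ, 0 < η₀ ∧ ∀ η : ℝ, 0 < η → η < η₀ → ∀ Φ : (N : ℕ) → Flow σ N, ShareLDAt σ θ δ h η Φ := by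
  intro σ θ H δ h hδ hh
  obtain ⟨η₀, hη₀, H'⟩ := H (δ / 2) (h + 1) (by positivity) (by linarith)
  refine ⟨η₀, hη₀, fun η hη hηlt Φ => ?_⟩
  intro Δ hΔp hΔ0 hΔg S r hS hr
  have hRB : RowBudgetN σ := stub_rowBudgetN σ
  filter_upwards [H' η hη hηlt Δ hΔp hΔ0 hΔg S r hS hr] with N hN
  set F := (Finset.univ : Finset (Finset (Fin (N + 1)))).filter
      (fun A => δ / 2 * ((N : ℝ) + 1) ≤ (A.card : ℝ)) with hF
  set E : Finset (Fin (N + 1)) → Set (Cfg N) :=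
    fun A => {y : Cfg N | ∀ i ∈ A, δ / 2 ≤ degScore σ N y (Δ N) S r η i} with hE
  have hsub : {y : Cfg N | δ ≤ degFr σ N y (Δ N) S r η} ⊆ ⋃ A ∈ F, E A :=
    ShareLD.setOf_le_degFr_subset hRB N (Δ N) S r η δ hδ.le
  have hx0 : (0 : ℝ) ≤ Real.exp (-((h + 1) * ((N : ℝ) + 1))) := (Real.exp_pos _).le
  calc eqLaw σ θ N (Φ N) {y : Cfg N | δ ≤ degFr σ N y (Δ N) S r η}
      ≤ eqLaw σ θ N (Φ N) (⋃ A ∈ F, E A) := measure_mono hsub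
    _ ≤ ∑ A ∈ F, eqLaw σ θ N (Φ N) (E A) := measure_biUnion_finset_le F E
    _ ≤ ∑ _A ∈ F, ENNReal.ofReal (Real.exp (-((h + 1) * ((N : ℝ) + 1)))) :=
        Finset.sum_le_sum fun A hA => hN (Φ N) A (Finset.mem_filter.1 hA).2
    _ = (F.card : ℝ≥0∞) * ENNReal.ofReal (Real.exp (-((h + 1) * ((N : ℝ) + 1)))) := by
        rw [Finset.sum_const, nsmul_eq_mul]
    _ ≤ ((2 ^ (N + 1) : ℕ) : ℝ≥0∞) * ENNReal.ofReal (Real.exp (-((h + 1) * ((N : ℝ) + 1)))) := by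
        gcongr
        exact_mod_cast ShareLD.card_filter_sets_le N _
    _ = ENNReal.ofReal ((2 : ℝ) ^ (N + 1) * Real.exp (-((h + 1) * ((N : ℝ) + 1)))) := by
        have hcast : ((2 ^ (N + 1) : ℕ) : ℝ≥0∞) = ENNReal.ofReal ((2 : ℝ) ^ (N + 1)) := by
          rw [← ENNReal.ofReal_natCast, Nat.cast_pow, Nat.cast_ofNat]
        rw [hcast, ← ENNReal.ofReal_mul (by positivity)]
    _ ≤ ENNReal.ofReal (Real.exp (-(h * ((N : ℝ) + 1)))) := by
        refine ENNReal.ofReal_le_ofReal ?_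
        have := ShareLD.two_pow_mul_exp_le h (N + 1)
        push_cast at this
        exact this

end

end Summit.AtomisticToContinuum.HydrodynamicLimit.Theorems.DiffuseBackwardInfluenceShare
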